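import Summits.FinalStateConjecture.FinalStateConjecture.Theorems.EIHFluxBalanceInertialRecessionStubWindowChargesSphere
import Summits.FinalStateConjecture.FinalStateConjecture.Theorems.EIHFluxBalanceInertialRecessionStubWindowChargesPointwise

/-!
# Window charges (stub `stub_windowCharges`): differentiating sphere integrals along moving spheres

Helper file for the line `sublinear-is-free-clean-window-charges` of the crux `InertialRecession`
(item `stmt-FinalStateConjecture-10166`), stub `stub_windowCharges`.

For a field of bilinear forms `g` which is `C^∞` and nondegenerate on an open `W ⊆ E4`, and `C¹`
paths `c : ℝ → E3`, `R : ℝ → ℝ`, the Landau–Lifshitz quasi-local momentum of the moving coordinate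
sphere `S_t = {x⁰ = t, |y − c(t)| = R(t)} ⊆ W` reads, in polar form (file `…Sphere`),
`P^μ(t) = κ R(t)² Q(t)`, `Q(t) = ∫ Σ_j h^{μ0j}(t, c(t) + R(t)α) α_j dτ(α)`. Here:

* `hasDerivAt_integral_moving` — `Q` is differentiable, with derivative the `τ`-integral of the
  `t`-derivative `Σ_j Dh^{μ0j}(t, c + Rα)(1, ċ + Ṙα) α_j` of the integrand (differentiation under
  the integral sign over the compact unit sphere: the integrand is `C¹` in `t` as long as the
  spheres stay inside `W`, with derivative bounded by continuity on `[t₀ − ε, t₀ + ε] × S²`);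
* `transport_pointwise_algebra` — the polynomial identity behind the transport theorem of file
  `…Transport` (time derivative of the density, minus the divergence of one antisymmetric matrix
  field, equals `R²[(Ṙ + ċ·α) emComplex^{μ0} − Σ_j emComplex^{μj} α_j]`).
-/

noncomputable section

-- instance search on the nested operator spaces `E4 →L[ℝ] E4 →L[ℝ] ℝ` is deep
set_option maxSynthPendingDepth 3

open Set Filter Metric MeasureTheory MeasureTheory.Measure
open scoped Topology

namespace Summit.FinalStateConjecture.FinalStateConjecture.Theorems.SublinearIsFree.WindowCharges

open Literature.Geometry.Lorentzian Literature.Geometry.Lorentzian.LandauLifshitz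

/-! ### The algebra of the transport identity -/

/-- **The transport identity, algebraic skeleton.** With `F_j = h^{μ0j}`,
`P_{jk} = ∂_{k+1} h^{μ0j}`,
`dA_{jk} = ∂_{k+1} h^{μjk}`, `d0H_j = ∂_0 h^{μ0j} = −E_j + Σ_k dA_{jk}` (`E_j = emComplex^{μ,j+1}`),
`E0 = emComplex^{μ0} = Σ_k P_{kk}`, unit normal `α` (`Σ α_k² = 1`), centre velocity `a` and radial
speed `r`: the `t`-derivative of `R² Σ_j F_j α_j` minus the flux density of the antisymmetric field
`R² h^{μjk} + R²(F_j a_k − F_k a_j) + R r (F_j z_k − F_k z_j)` at `z = R α` is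
`R²[(r + a·α) E0 − Σ_j E_j α_j]`. [folklore] -/
theorem transport_pointwise_algebra (F d0H E α a : Fin 3 → ℝ) (P dA : Fin 3 → Fin 3 → ℝ)
    (E0 ρ r : ℝ) (hE0 : E0 = ∑ k, P k k) (hd0 : ∀ j, d0H j = -E j + ∑ k, dA j k)
    (hα : ∑ k, α k ^ 2 = 1) :
    2 * ρ * r * (∑ j, F j * α j) + ρ ^ 2 * ∑ j, (d0H j + ∑ k, (a k + r * α k) * P j k) * α j =
      ρ ^ 2 * ((r + ∑ k, a k * α k) * E0 - ∑ j, E j * α j) +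
        ∑ j, (∑ k, (ρ ^ 2 * dA j k + ρ ^ 2 * (P j k * a k - P k k * a j) +
          ρ * r * (F j + ρ * α k * P j k - F k * (if j = k then 1 else 0) - ρ * α j * P k k))) *
            α j := by
  simp only [Fin.sum_univ_three, hd0, hE0] at hα ⊢
  simp only [Fin.isValue, ↓reduceIte, Fin.reduceEq, mul_one, mul_zero, sub_zero]
  linear_combination (ρ ^ 2 * r * (P 0 0 + P 1 1 + P 2 2)) * hα

/-! ### Continuity and integrability over the unit sphere -/

/-- Continuous functions on the unit sphere of `E3` are `τ`-integrable (`τ = volume.toSphere` is a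
finite measure on a compact space). [folklore] -/
theorem integrable_toSphere_of_continuous {f : sphere (0 : E3) 1 → ℝ} (hf : Continuous f) :
    Integrable f (volume : Measure E3).toSphere :=
  integrableOn_univ.1 (hf.continuousOn.integrableOn_compact isCompact_univ)

/-- The coordinates `α ↦ α_j` are continuous on the unit sphere. [folklore] -/
theorem continuous_coe_unitSphere_apply (j : Fin 3) :
    Continuous fun α : sphere (0 : E3) 1 ↦ (α : E3) j :=
  (EuclideanSpace.proj j).continuous.comp continuous_subtype_val

/-- **Joint continuity of moving points**: `(t, α) ↦ (t, c(t) + R(t) α) ∈ E4` is continuous for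
continuous `c`, `R`. [folklore] -/
theorem continuous_moving_point {c : ℝ → E3} {R : ℝ → ℝ} (hc : Continuous c) (hR : Continuous R) :
    Continuous fun p : ℝ × sphere (0 : E3) 1 ↦
      E4.ofTimeSpace p.1 (c p.1 + R p.1 • ((p.2 : sphere (0 : E3) 1) : E3)) := by
  obtain ⟨L, hL⟩ := exists_clm_ofTimeSpace_zero
  have hfun : (fun p : ℝ × sphere (0 : E3) 1 ↦
      E4.ofTimeSpace p.1 (c p.1 + R p.1 • ((p.2 : sphere (0 : E3) 1) : E3))) =
      fun p ↦ p.1 • E4.basisVector 0 + L (c p.1 + R p.1 • ((p.2 : sphere (0 : E3) 1) : E3)) := by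
    funext p
    rw [ofTimeSpace_eq_smul_add_ofTimeSpace_zero, hL]
  rw [hfun]
  exact (continuous_fst.smul continuous_const).add (L.continuous.comp
    ((hc.comp continuous_fst).add ((hR.comp continuous_fst).smul
      (continuous_subtype_val.comp continuous_snd))))

/-- **Continuity of the velocity vectors** `(t, α) ↦ (1, c'(t) + R'(t) α)`. [folklore] -/
theorem continuous_velocity {c' : ℝ → E3} {R' : ℝ → ℝ} (hc : Continuous c') (hR : Continuous R') :
    Continuous fun p : ℝ × sphere (0 : E3) 1 ↦
      E4.ofTimeSpace 1 (c' p.1 + R' p.1 • ((p.2 : sphere (0 : E3) 1) : E3)) := by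
  obtain ⟨L, hL⟩ := exists_clm_ofTimeSpace_zero
  have hfun : (fun p : ℝ × sphere (0 : E3) 1 ↦
      E4.ofTimeSpace 1 (c' p.1 + R' p.1 • ((p.2 : sphere (0 : E3) 1) : E3))) =
      fun p ↦ (1 : ℝ) • E4.basisVector 0 +
        L (c' p.1 + R' p.1 • ((p.2 : sphere (0 : E3) 1) : E3)) := by
    funext p
    rw [ofTimeSpace_eq_smul_add_ofTimeSpace_zero, hL]
  rw [hfun]
  exact continuous_const.add (L.continuous.comp
    ((hc.comp continuous_fst).add ((hR.comp continuous_fst).smul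
      (continuous_subtype_val.comp continuous_snd))))

/-! ### Differentiation under the integral sign along moving spheres -/

/-- **Unit-sphere integrals along moving spheres are differentiable in time.** Let `H_j`
(`j < 3`) be `C¹` on the open `W ⊆ E4`, `c`, `R` of class `C¹`, and suppose the moving points
`(t, c(t) + R(t)α)` stay in `W` for `|t − t₀| ≤ ε` and all unit vectors `α`. Then
`Q(t) = ∫ Σ_j H_j(t, c(t) + R(t)α) α_j dτ(α)` has at `t₀` the derivative
`∫ Σ_j DH_j(t₀, c + Rα)(1, ċ + Ṙα) α_j dτ(α)`, and the latter integrand is integrable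
(differentiation under the integral sign, dominated by continuity on the compact
`[t₀ − ε, t₀ + ε] × S²`). [folklore] -/
theorem hasDerivAt_integral_moving' {W : Set E4} (hW : IsOpen W) {H : Fin 3 → E4 → ℝ}
    (hH : ∀ j, ContDiffOn ℝ 1 (H j) W) {c : ℝ → E3} {R : ℝ → ℝ} (hc : ContDiff ℝ 1 c)
    (hR : ContDiff ℝ 1 R) {t₀ ε : ℝ} (hε : 0 < ε)
    (hmem : ∀ t ∈ Icc (t₀ - ε) (t₀ + ε), ∀ α : sphere (0 : E3) 1,
      E4.ofTimeSpace t (c t + R t • (α : E3)) ∈ W) :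
    Integrable (fun α : sphere (0 : E3) 1 ↦ ∑ j : Fin 3,
        fderiv ℝ (H j) (E4.ofTimeSpace t₀ (c t₀ + R t₀ • (α : E3)))
          (E4.ofTimeSpace 1 (deriv c t₀ + deriv R t₀ • (α : E3))) * (α : E3) j)
        (volume : Measure E3).toSphere ∧
      HasDerivAt (fun t ↦ ∫ α : sphere (0 : E3) 1, ∑ j : Fin 3,
          H j (E4.ofTimeSpace t (c t + R t • (α : E3))) * (α : E3) j
            ∂(volume : Measure E3).toSphere)
        (∫ α : sphere (0 : E3) 1, ∑ j : Fin 3,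
          fderiv ℝ (H j) (E4.ofTimeSpace t₀ (c t₀ + R t₀ • (α : E3)))
            (E4.ofTimeSpace 1 (deriv c t₀ + deriv R t₀ • (α : E3))) * (α : E3) j
              ∂(volume : Measure E3).toSphere) t₀ := by
  set S : Set ℝ := Icc (t₀ - ε) (t₀ + ε) with hS
  have hSn : S ∈ 𝓝 t₀ := Icc_mem_nhds (by linarith) (by linarith)
  have ht₀ : t₀ ∈ S := ⟨by linarith, by linarith⟩
  -- continuity of the data
  have hcc : Continuous c := hc.continuous
  have hRc : Continuous R := hR.continuous
  have hdc : Continuous (deriv c) := hc.continuous_deriv le_rfl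
  have hdR : Continuous (deriv R) := hR.continuous_deriv le_rfl
  have hpt := continuous_moving_point hcc hRc
  have hvel := continuous_velocity hdc hdR
  -- the compact set swept by the spheres, inside `W`
  set K : Set E4 := (fun p : ℝ × sphere (0 : E3) 1 ↦
    E4.ofTimeSpace p.1 (c p.1 + R p.1 • ((p.2 : sphere (0 : E3) 1) : E3))) '' (S ×ˢ univ) with hK
  have hKc : IsCompact K := (isCompact_Icc.prod isCompact_univ).image hpt
  have hKW : K ⊆ W := by
    rintro _ ⟨⟨t, α⟩, ⟨ht, -⟩, rfl⟩
    exact hmem t ht α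
  have hmemK : ∀ t ∈ S, ∀ α : sphere (0 : E3) 1,
      E4.ofTimeSpace t (c t + R t • (α : E3)) ∈ K := fun t ht α ↦ ⟨(t, α), ⟨ht, mem_univ _⟩, rfl⟩
  -- bounds
  have hfc : ∀ j, ContinuousOn (fderiv ℝ (H j)) W := fun j ↦
    (hH j).continuousOn_fderiv_of_isOpen hW le_rfl
  have hM : ∀ j, ∃ M, ∀ x ∈ K, ‖fderiv ℝ (H j) x‖ ≤ M := fun j ↦
    hKc.exists_bound_of_continuousOn ((hfc j).mono hKW)
  choose M hM using hM
  obtain ⟨N, hN⟩ := (isCompact_Icc.prod (isCompact_univ (X := sphere (0 : E3) 1)))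
    |>.exists_bound_of_continuousOn (s := S ×ˢ univ) hvel.continuousOn
  -- differentiability of the `H j` on `W`
  have hHd : ∀ j, ∀ x ∈ W, DifferentiableAt ℝ (H j) x := fun j x hx ↦
    ((hH j).differentiableOn one_ne_zero).differentiableAt (hW.mem_nhds hx)
  have hcd : ∀ t, HasDerivAt c (deriv c t) t := fun t ↦
    ((hc.differentiable one_ne_zero) t).hasDerivAt
  have hRd : ∀ t, HasDerivAt R (deriv R t) t := fun t ↦
    ((hR.differentiable one_ne_zero) t).hasDerivAt
  -- continuity of the integrands in `α` for `t ∈ S`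
  have hF_cont : ∀ t ∈ S, Continuous fun α : sphere (0 : E3) 1 ↦ ∑ j : Fin 3,
      H j (E4.ofTimeSpace t (c t + R t • (α : E3))) * (α : E3) j := by
    intro t ht
    refine continuous_finsetSum _ fun j _ ↦ Continuous.mul ?_ (continuous_coe_unitSphere_apply j)
    exact (hH j).continuousOn.comp_continuous (hpt.comp (Continuous.prodMk_right t))
      fun α ↦ hmem t ht α
  have hF'_cont : ∀ t ∈ S, Continuous fun α : sphere (0 : E3) 1 ↦ ∑ j : Fin 3,
      fderiv ℝ (H j) (E4.ofTimeSpace t (c t + R t • (α : E3)))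
        (E4.ofTimeSpace 1 (deriv c t + deriv R t • (α : E3))) * (α : E3) j := by
    intro t ht
    refine continuous_finsetSum _ fun j _ ↦ Continuous.mul ?_ (continuous_coe_unitSphere_apply j)
    refine (((hfc j).comp_continuous (hpt.comp (Continuous.prodMk_right t))
      fun α ↦ hmem t ht α).clm_apply (hvel.comp (Continuous.prodMk_right t)))
  refine hasDerivAt_integral_of_dominated_loc_of_deriv_le (𝕜 := ℝ) (E := ℝ)
    (μ := (volume : Measure E3).toSphere)
    (F := fun t (α : sphere (0 : E3) 1) ↦ ∑ j : Fin 3,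
      H j (E4.ofTimeSpace t (c t + R t • (α : E3))) * (α : E3) j)
    (F' := fun t (α : sphere (0 : E3) 1) ↦ ∑ j : Fin 3,
      fderiv ℝ (H j) (E4.ofTimeSpace t (c t + R t • (α : E3)))
        (E4.ofTimeSpace 1 (deriv c t + deriv R t • (α : E3))) * (α : E3) j)
    (bound := fun _ ↦ ∑ j : Fin 3, M j * N) hSn ?_ ?_ ?_ ?_ (integrable_const _) ?_
  · exact eventually_of_mem hSn fun t ht ↦ (hF_cont t ht).aestronglyMeasurable
  · exact integrable_toSphere_of_continuous (hF_cont t₀ ht₀)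
  · exact (hF'_cont t₀ ht₀).aestronglyMeasurable
  · refine ae_of_all _ fun α t ht ↦ ?_
    refine (norm_sum_le _ _).trans (Finset.sum_le_sum fun j _ ↦ ?_)
    rw [norm_mul]
    have h1 : ‖fderiv ℝ (H j) (E4.ofTimeSpace t (c t + R t • (α : E3)))
        (E4.ofTimeSpace 1 (deriv c t + deriv R t • (α : E3)))‖ ≤ M j * N := by
      refine (ContinuousLinearMap.le_opNorm _ _).trans ?_
      have hMj := hM j _ (hmemK t ht α)
      have hNt := hN (t, α) ⟨ht, mem_univ _⟩
      have hM0 : 0 ≤ M j := (norm_nonneg _).trans hMj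
      exact mul_le_mul hMj hNt (norm_nonneg _) hM0
    have h2 : ‖(α : E3) j‖ ≤ 1 := by
      rw [Real.norm_eq_abs]
      exact abs_coe_unitSphere_apply_le α j
    have h0 : 0 ≤ M j * N :=
      le_trans (norm_nonneg _) h1
    calc _ ≤ M j * N * 1 := mul_le_mul h1 h2 (norm_nonneg _) h0
      _ = M j * N := mul_one _
  · refine ae_of_all _ fun α t ht ↦ ?_
    refine HasDerivAt.fun_sum fun j _ ↦ ?_
    have hx : E4.ofTimeSpace t (c t + R t • (α : E3)) ∈ W := hmem t ht α
    exact ((hHd j _ hx).hasFDerivAt.comp_hasDerivAt t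
      (hasDerivAt_ofTimeSpace_moving (hcd t) (hRd t) (α : E3))).mul_const _

/-- **Unit-sphere integrals along moving spheres are differentiable in time** — the registered
sub-goal form (stub `hasDerivAt_integral_moving` of the crux item) of `hasDerivAt_integral_moving'`
(its derivative clause). [folklore] -/
theorem hasDerivAt_integral_moving : open Literature.Geometry.Lorentzian MeasureTheory Metric in ∀ (W : Set E4) (H : Fin 3 → E4 → ℝ) (c : ℝ → E3) (R : ℝ → ℝ) (t₀ ε : ℝ), IsOpen W → (∀ j, ContDiffOn ℝ 1 (H j) W) → ContDiff ℝ 1 c → ContDiff ℝ 1 R → 0 < ε → (∀ t ∈ Set.Icc (t₀ - ε) (t₀ + ε), ∀ α : sphere (0 : E3) 1, E4.ofTimeSpace t (c t + R t • (α : E3)) ∈ W) → HasDerivAt (fun t ↦ ∫ α : sphere (0 : E3) 1, ∑ j : Fin 3, H j (E4.ofTimeSpace t (c t + R t • (α : E3))) * (α : E3) j ∂(volume : Measure E3).toSphere) (∫ α : sphere (0 : E3) 1, ∑ j : Fin 3, fderiv ℝ (H j) (E4.ofTimeSpace t₀ (c t₀ + R t₀ • (α : E3))) (E4.ofTimeSpace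 1 (deriv c t₀ + deriv R t₀ • (α : E3))) * (α : E3) j ∂(volume : Measure E3).toSphere) t₀ :=
  fun _ _ _ _ _ _ hW hH hc hR hε hmem ↦ (hasDerivAt_integral_moving' hW hH hc hR hε hmem).2

end Summit.FinalStateConjecture.FinalStateConjecture.Theorems.SublinearIsFree.WindowCharges

end
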